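import Summits.BirchSwinnertonDyer.BirchSwinnertonDyer.Theorems.GenusKolyvaginAtTwoGenusPrimitiveSupplyAtTwoArchimedeanRootNumber
import Summits.BirchSwinnertonDyer.BirchSwinnertonDyer.Theorems.GenusKolyvaginAtTwoGenusPrimitiveSupplyAtTwoArchimedeanSupplyFree
import Summits.BirchSwinnertonDyer.BirchSwinnertonDyer.Theorems.GenusKolyvaginAtTwoGenusPrimitiveSupplyAtTwoSupplyDEF1OfFacts
import Summits.BirchSwinnertonDyer.BirchSwinnertonDyer.Theorems.GenusKolyvaginAtTwoGenusPrimitiveSupplyAtTwoArchimedeanRootNumberEll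
import HarnessLib

/-!
# Route `GenusKolyvaginAtTwo`, crux #2 `GenusPrimitiveSupplyAtTwo` (stmt-BirchSwinnertonDyer-22136):
# SUPPLY″ on the WHOLE habitat modulo the ROUTE's print items {`ModularityExistsNewform`, `TwoParityDD`, `CasselsTatePairingRat`} ONLY —
# no Mazur–Rubin named fact, no Kramer congruence, no cell statement, no rank hypothesis

Width seat `bsd-line-gk2-p5` g10 (cell `bsd-f1-sign2`, SUPPLY lineage), file 33 of the series (sequel of `…ArchimedeanRootNumber.lean`
and `…ArchimedeanSupplyFree.lean` p640081; joins gk2-p4's `…SupplyDEF1OfFacts.lean` p629230). THEOREMS ONLY (no definition, no named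
fact, no `sorry`, no local instance); helper `--supports stmt-BirchSwinnertonDyer-22136`; no item is closed; BSD is not proved by any of this.

WHAT. The lineage's SUPPLY″ (beyond every bound a prime `ℓ ≡ 7 (8)`, `ℓ ∤ N_W`, with `K = ℚ(√−ℓ)` carrying every `K`-clause of crux 22136,
`2` split, DEF = 1, and a globally minimal twin `Wd ≅ W^{(−ℓ)}` with `#Sel₂(Wd) = 2`, for every habitat curve `W` with `#Sel₂(W) ∈ {1,4}`
and `¬DescentSignNeg W` on `{Δ > 0, #Sel₂ = 4}`) existed on two bases: file 28 `supply_DEF1_minimalTwin_of_parity''` modulo {PT, Tate χ,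
Kramer parity} (a Literature fact outside the route's split, with the `huniq` defect) and gk2-p4's `supply_DEF1_minimalTwin_of_facts`
modulo {PT, Tate χ, 2-parity, Cassels–Tate, modularity, T-A, T-V} (two cell statements BY NAME, and a rank-`0` hypothesis). File 32
proved the T-A / T-V dichotomies per curve from {modularity, 2-parity, Cassels–Tate}; Poitou–Tate and Tate χ are tree theorems. Hence:

* §80 `supply_DEF1_posDisc_of_print` (`{Δ > 0, #Sel₂ = 1}`), `descentSignNeg_or_forall_minimalTwin_of_print` (`{Δ > 0, #Sel₂ = 4}`);
* §81 **`supply_DEF1_minimalTwin_of_print` / `supply_DEF1_minimalTwin_habitat_of_print` — SUPPLY″ for every habitat curve, CONDITIONAL on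
  the three ROUTE items `ModularityExistsNewform` (stmt-19382), `TwoParityDD` (stmt-24949), `CasselsTatePairingRat` (stmt-19420) ONLY**
  — the same print children the crux closer `GenusKolyLowering.genusPrimitiveSupplyAtTwo_of_kernels` (p636890) already consumes; so the
  twin-supply half of crux 22136 adds NOTHING to the crux's cone beyond its own route items. The twin's analytic rank one is NOT asserted
  (that is CONV₂ / Gross–Zagier); BSD is not proved by any of this.

References: [MazurRubin2010] Prop. 3.3, Cor. 3.4 (i), Prop. 5.3; [Kramer1981] §2 Prop. 6, Thm. 1; [DokchitserDokchitserAnnals2010] Thm. 1.4;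
[Cassels1962ArithmeticIV]; [BCDTJAMS2001] Thm. A; [GrossLMS1991] §1 (p. 235); [MilneADT2006] I Thm. 2.8, 4.10, 6.13.
-/

set_option linter.dupNamespace false -- tree convention: `Summit.BirchSwinnertonDyer.BirchSwinnertonDyer.Theorems` (summit = sub-problem)
set_option autoImplicit false

noncomputable section

open scoped Classical

open NumberField WeierstrassCurve IsDedekindDomain
open Literature.NumberTheory.EllipticCurves Literature.NumberTheory.QuadraticFields
open Literature.NumberTheory.GaloisRepresentations Literature.NumberTheory.GaloisCohomology Literature.NumberTheory
open Literature.NumberTheory.EllipticCurves.ModularForms (exists_isNewformOf)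
open Summit.BirchSwinnertonDyer.Rank1Residual.F1Sign2

namespace Summit.BirchSwinnertonDyer.BirchSwinnertonDyer.Theorems.GenusKolyTwin

open Summit.BirchSwinnertonDyer.BirchSwinnertonDyer.Theorems.GenusKolyTwistingPrime (supply_DEF1_minimalTwin_rowOne_of_duality)
open Summit.BirchSwinnertonDyer.BirchSwinnertonDyer.Theorems.GenusKolyArch
open Summit.BirchSwinnertonDyer.BirchSwinnertonDyer.Theorems.SchneiderFreeAdditiveX3.PoitouTateReduction
  (poitouTate_selmerStructure_duality_real_holds)
open Summit.BirchSwinnertonDyer.BirchSwinnertonDyer.Theses.GenusKolyvaginAtTwo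
  (ModularityExistsNewform TwoParityDD CasselsTatePairingRat)

variable (W : WeierstrassCurve ℚ) [W.IsElliptic] [W.IsGloballyMinimal]

/-! ## §80 The two `Δ > 0` rows, modulo {modularity, 2-parity, Cassels–Tate} -/

/-- **SUPPLY″ on `{Δ_W > 0, #Sel₂(W) = 1}` modulo {modularity, 2-parity, Cassels–Tate}** (file 26's `supply_DEF1_posDisc_of_parity` with
T-A's dichotomy taken from file 32's `admissibleTwistSelmerShiftAt_of_print` instead of Kramer's congruence): for `W/ℚ` globally minimal
elliptic with `ρ̄_{W,2}` onto, `Δ_W > 0`, `#Sel₂(W) = 1`, beyond every bound a silent admissible prime `ℓ ≡ 7 (8)` with the DEF = 1 field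
`ℚ(√−ℓ)` and a globally minimal twin with `#Sel₂ = 2`. [cite: MazurRubin2010, Prop. 3.3, Cor. 3.4 (i)] [cite: Kramer1981, §2 Prop. 6]
[cite: DokchitserDokchitserAnnals2010, Thm. 1.4] -/
theorem supply_DEF1_posDisc_of_print (hmod : exists_isNewformOf) (hpar : ∀ V : WeierstrassCurve ℚ, p_parity V 2)
    (hCT : WeierstrassCurve.exists_casselsTate_pairing (K := ℚ)) (hΔ : 0 < W.Δ)
    (hsurj : W.HasSurjectiveModNGaloisRep 2) (h1 : Nat.card (W.selmerGroup 2) = 1) (b : ℕ) :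
    ∃ ℓ : ℕ, b < ℓ ∧ ℓ.Prime ∧
      (∀ x : ZMod ℓ, 4 * x ^ 3 + ((integralModelInt W).b₂ : ZMod ℓ) * x ^ 2 +
        2 * ((integralModelInt W).b₄ : ZMod ℓ) * x + ((integralModelInt W).b₆ : ZMod ℓ) ≠ 0) ∧
      ∃ (K : Type) (_ : Field K) (_ : NumberField K), IsImaginaryQuadratic K ∧ discr K = -(ℓ : ℤ) ∧ Odd (discr K) ∧
        discr K ≠ -3 ∧ SatisfiesHeegnerHypothesis (W.conductorNorm ℤ) K ∧
        ¬ IsSquare ((discr K : ℚ) * -|W.Δ|) ∧ ¬ IsSquare ((discr K : ℚ) * (-(2 * |W.Δ|))) ∧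
        ((Ideal.span {(2 : ℤ)}).primesOver (𝓞 K)).ncard = 2 ∧
        (∀ [Fact ℓ.Prime], ∀ Q : (W.baseChange ℚ_[ℓ]).toAffine.Point, 2 • Q = 0 → Q = 0) ∧
        ∃ (Wd : WeierstrassCurve ℚ) (_ : Wd.IsElliptic) (_ : Wd.IsGloballyMinimal),
          (∃ C : VariableChange ℚ, C • W.quadraticTwist (discr K : ℚ) = Wd) ∧ Nat.card (Wd.selmerGroup 2) = 2 := by
  have hT : NoRationalTwoTorsion W := noRationalTwoTorsion_of_hasSurjectiveModNGaloisRep W (by simpa using hsurj)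
  obtain ⟨ℓ, hb, hℓ, hℓ8, hℓN, hsil⟩ := exists_silent_prime_gt W hΔ hsurj b
  exact ⟨ℓ, hb, hℓ, hsil, supply_DEF1_posDisc_of_shiftAt W
    (fun d hd ↦ admissibleTwistSelmerShiftAt_of_print W hmod hpar hCT hΔ hT hd) h1 hℓ hℓ8 hℓN hsil⟩

/-- **Row 1 on `Δ > 0` is decided by the descent sign, modulo {modularity, 2-parity, Cassels–Tate}** (file 28's
`descentSignNeg_or_forall_minimalTwin_of_parity` with T-V from file 32's `strictShaPropagationAt_of_print`).
[cite: MazurRubin2010, Cor. 3.4 (i)] [cite: Kramer1981, §2 Prop. 6] [cite: DokchitserDokchitserAnnals2010, Thm. 1.4] -/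
theorem descentSignNeg_or_forall_minimalTwin_of_print (hmod : exists_isNewformOf) (hpar : ∀ V : WeierstrassCurve ℚ, p_parity V 2)
    (hCT : WeierstrassCurve.exists_casselsTate_pairing (K := ℚ)) (hΔ : 0 < W.Δ)
    (hsurj : W.HasSurjectiveModNGaloisRep 2) (h4 : Nat.card (W.selmerGroup 2) = 4) :
    DescentSignNeg W ∨
      ∀ d : ℤ, DescAdmissible W d → ∀ (Wd : WeierstrassCurve ℚ) [Wd.IsElliptic],
        (∃ C : VariableChange ℚ, C • W.quadraticTwist (d : ℚ) = Wd) → Nat.card (Wd.selmerGroup 2) = 2 := by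
  have hT : NoRationalTwoTorsion W := noRationalTwoTorsion_of_hasSurjectiveModNGaloisRep W (by simpa using hsurj)
  rcases strictShaPropagationAt_of_print W hmod hpar hCT hΔ hT (by rw [selmerTwoCard, h4]) with hall | hall
  · right
    intro d hd Wd _ hWd
    rw [natCard_selmerGroup_model_eq_twistSelmerTwoCard W hd.1.ne Wd hWd, hall d hd]
  · left
    obtain ⟨ℓ, -, hℓ, hℓ8, hℓN, hsil⟩ := exists_silent_prime_gt W hΔ hsurj 0
    refine ⟨-(ℓ : ℤ), descAdmissible_neg_prime_of_silent W hℓ hℓ8 hℓN hsil, ?_⟩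
    rw [hall _ (descAdmissible_neg_prime_of_silent W hℓ hℓ8 hℓN hsil), selmerTwoCard, h4]

/-! ## §81 SUPPLY″ on the whole habitat modulo the route's print items only -/

/-- **SUPPLY″ FOR EVERY HABITAT CURVE, modulo {modularity, 2-parity, Cassels–Tate} ONLY** — file 28's `supply_DEF1_minimalTwin_of_parity''`
VERBATIM with Kramer's congruence replaced by the three published inputs the route already lists as items (and still no T-A, no T-V, no
rank hypothesis). For `W/ℚ` globally minimal elliptic with `ρ̄_{W,2}` onto, `#Sel₂(W) ∈ {1, 4}`, and `¬ F1Sign2.DescentSignNeg W` whenever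
`Δ_W > 0` and `#Sel₂(W) = 4`: beyond every bound `b` a prime `ℓ ≡ 7 (mod 8)`, `ℓ ∤ N_W`, with `K = ℚ(√−ℓ)` carrying EVERY K-clause of
crux 22136, `2` split, DEF(W,K) = 1 (root-count currency), and a GLOBALLY MINIMAL twin `Wd ≅ W^{(−ℓ)}` with `#Sel₂(Wd) = 2`. Rows:
`{Δ<0, #Sel₂=1}` gk2-p4 `exists_prime_heegnerField_minimalTwin_of_facts`; `{Δ<0, #Sel₂=4}` `supply_DEF1_minimalTwin_rowOne_of_duality`;
`{Δ>0, #Sel₂=1}` §80; `{Δ>0, #Sel₂=4}` file 28's row-1 theorem fed by file 32's T-V dichotomy. Poitou–Tate / Tate χ are the tree theorems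
`poitouTate_selmerStructure_duality_real_holds`, `GenusKolyLowering.localEP`. The twin's analytic rank one is NOT asserted.
[cite: MazurRubin2010, Prop. 3.3, Cor. 3.4 (i), Prop. 5.3] [cite: Kramer1981, Prop. 6] [cite: DokchitserDokchitserAnnals2010, Thm. 1.4]
[cite: GrossLMS1991, §1 (p. 235)] -/
theorem supply_DEF1_minimalTwin_of_print (hmod : exists_isNewformOf) (hpar : ∀ V : WeierstrassCurve ℚ, p_parity V 2)
    (hCT : WeierstrassCurve.exists_casselsTate_pairing (K := ℚ))
    (hsurj : W.HasSurjectiveModNGaloisRep 2)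
    (h14 : Nat.card (W.selmerGroup 2) = 1 ∨ Nat.card (W.selmerGroup 2) = 4)
    (hε : 0 < W.Δ → Nat.card (W.selmerGroup 2) = 4 → ¬ DescentSignNeg W) (b : ℕ) :
    ∃ ℓ : ℕ, b < ℓ ∧ ℓ.Prime ∧ ℓ % 8 = 7 ∧ ¬ ℓ ∣ W.conductorNorm ℤ ∧
      ((W.Δ < 0 ∧ ∃! x : ZMod ℓ, 4 * x ^ 3 + ((integralModelInt W).b₂ : ZMod ℓ) * x ^ 2 +
          2 * ((integralModelInt W).b₄ : ZMod ℓ) * x + ((integralModelInt W).b₆ : ZMod ℓ) = 0) ∨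
        (0 < W.Δ ∧ ∀ x : ZMod ℓ, 4 * x ^ 3 + ((integralModelInt W).b₂ : ZMod ℓ) * x ^ 2 +
          2 * ((integralModelInt W).b₄ : ZMod ℓ) * x + ((integralModelInt W).b₆ : ZMod ℓ) ≠ 0)) ∧
      ∃ (K : Type) (_ : Field K) (_ : NumberField K), IsImaginaryQuadratic K ∧ discr K = -(ℓ : ℤ) ∧ Odd (discr K) ∧
        discr K ≠ -3 ∧ SatisfiesHeegnerHypothesis (W.conductorNorm ℤ) K ∧
        ¬ IsSquare ((discr K : ℚ) * -|W.Δ|) ∧ ¬ IsSquare ((discr K : ℚ) * (-(2 * |W.Δ|))) ∧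
        ((Ideal.span {(2 : ℤ)}).primesOver (𝓞 K)).ncard = 2 ∧
        ∃ (Wd : WeierstrassCurve ℚ) (_ : Wd.IsElliptic) (_ : Wd.IsGloballyMinimal),
          (∃ C : VariableChange ℚ, C • W.quadraticTwist (discr K : ℚ) = Wd) ∧ Nat.card (Wd.selmerGroup 2) = 2 := by
  have hPT := poitouTate_selmerStructure_duality_real_holds (K := ℚ)
  have hEP := GenusKolyLowering.localEP ℚ
  have hT : NoRationalTwoTorsion W := noRationalTwoTorsion_of_hasSurjectiveModNGaloisRep W (by simpa using hsurj)
  rcases lt_or_gt_of_ne W.isUnit_Δ.ne_zero with hΔ | hΔ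
  · -- `Δ < 0`: prime Heegner fields are transposition fields (DEF = 1 for free)
    rcases h14 with h1 | h4
    · obtain ⟨K, _, _, ℓ, hℓ, hb, hK, hd, hodd, hd3, hH, hsq1, hsq2, h2K, huniq, Wd, _, _, hWd, hSel⟩ :=
        exists_prime_heegnerField_minimalTwin_of_facts W hPT hEP hpar hCT hmod hΔ h1 b
      obtain ⟨-, hℓN, -⟩ := prime_discr_facts W hK hodd hH hℓ hd
      have hℓ8 : ℓ % 8 = 7 := by
        have h8 := (Quadratic.ncard_primesOver_two_eq_two_iff hK.1).mp h2K
        rw [hd] at h8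
        omega
      exact ⟨ℓ, hb, hℓ, hℓ8, hℓN, Or.inl ⟨hΔ, huniq⟩, K, inferInstance, inferInstance, hK, hd, hodd, hd3, hH, hsq1, hsq2,
        h2K, Wd, inferInstance, inferInstance, hWd, hSel⟩
    · obtain ⟨ℓ, hℓ, hb, hℓ8, hℓ2N, K, _, _, hK, hd, hodd, hd3, hH, hsq1, hsq2, h2K, huniq, Wd, _, _, hWd, hSel⟩ :=
        supply_DEF1_minimalTwin_rowOne_of_duality W hPT hEP hΔ hsurj h4 b
      have hℓN : ¬ ℓ ∣ W.conductorNorm ℤ := fun h => hℓ2N (Dvd.dvd.mul_left h 2)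
      exact ⟨ℓ, hb, hℓ, hℓ8, hℓN, Or.inl ⟨hΔ, huniq⟩, K, inferInstance, inferInstance, hK, hd, hodd, hd3, hH, hsq1, hsq2,
        h2K, Wd, inferInstance, inferInstance, hWd, hSel⟩
  · -- `Δ > 0`: silent prime Heegner fields; `#Sel₂ = 1` by §80, `#Sel₂ = 4` through file 32's T-V dichotomy
    rcases h14 with h1 | h4
    · obtain ⟨ℓ, hb, hℓ, hsil, K, _, _, hK, hd, hodd, hd3, hH, hsq1, hsq2, h2K, -, Wd, _, _, hWd, hSel⟩ :=
        supply_DEF1_posDisc_of_print W hmod hpar hCT hΔ hsurj h1 b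
      obtain ⟨-, hℓN, -⟩ := prime_discr_facts W hK hodd hH hℓ hd
      have hℓ8 : ℓ % 8 = 7 := by
        have h8 := (Quadratic.ncard_primesOver_two_eq_two_iff hK.1).mp h2K
        rw [hd] at h8
        omega
      exact ⟨ℓ, hb, hℓ, hℓ8, hℓN, Or.inr ⟨hΔ, hsil⟩, K, inferInstance, inferInstance, hK, hd, hodd, hd3, hH, hsq1, hsq2,
        h2K, Wd, inferInstance, inferInstance, hWd, hSel⟩
    · obtain ⟨ℓ, hb, hℓ, hsil, K, _, _, hK, hd, hodd, hd3, hH, hsq1, hsq2, h2K, -, Wd, _, _, hWd, hSel⟩ :=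
        supply_DEF1_posDisc_rowOne_of_not_descentSignNegAt W
          (strictShaPropagationAt_of_print W hmod hpar hCT hΔ hT (by rw [selmerTwoCard, h4])) hΔ hsurj h4 (hε hΔ h4) b
      obtain ⟨-, hℓN, -⟩ := prime_discr_facts W hK hodd hH hℓ hd
      have hℓ8 : ℓ % 8 = 7 := by
        have h8 := (Quadratic.ncard_primesOver_two_eq_two_iff hK.1).mp h2K
        rw [hd] at h8
        omega
      exact ⟨ℓ, hb, hℓ, hℓ8, hℓN, Or.inr ⟨hΔ, hsil⟩, K, inferInstance, inferInstance, hK, hd, hodd, hd3, hH, hsq1, hsq2,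
        h2K, Wd, inferInstance, inferInstance, hWd, hSel⟩

/-! ## R-128 retype (director-bsd 2026-08-29 17:42Z, T-Q381-1′; seat bsd-line-gk2-p2 g21): PRINT-FORM TWINS
Every theorem below is the byte-identical twin of the theorem of the same name without the trailing prime, with the ONE change
that the `2`-parity hypothesis is typed as print has it — `∀ (V : WeierstrassCurve ℚ) [V.IsElliptic], p_parity V 2`
(Dokchitser–Dokchitser 2010 Thm. 1.4, elliptic curves; = route item `TwoParityDD` after rev 34) — instead of the bare closure
`∀ V : WeierstrassCurve ℚ, p_parity V 2` over all Weierstrass cubics (singular ones included: off print, undischargeable).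
Calls to other retyped theorems go to their primed twins; every application `hpar W` is at an elliptic curve, so the proofs are
unchanged. The unprimed originals are kept (append-only tree) and are superseded by these. BSD is NOT proved by any of this. -/

/-- **R-128 retype** (director-bsd 2026-08-29, T-Q381-1′) of `supply_DEF1_posDisc_of_print`: the SAME statement and proof with the `2`-parity hypothesis in PRINT form `∀ (V : WeierstrassCurve ℚ) [V.IsElliptic], p_parity V 2` (Dokchitser–Dokchitser 2010 Thm. 1.4 is about elliptic curves; the bare closure over all Weierstrass cubics was off print). **SUPPLY″ on `{Δ_W > 0, #Sel₂(W) = 1}` modulo {modularity, 2-parity, Cassels–Tate}** (file 26's `supply_DEF1_posDisc_of_parity` with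
T-A's dichotomy taken from file 32's `admissibleTwistSelmerShiftAt_of_print'` instead of Kramer's congruence): for `W/ℚ` globally minimal
elliptic with `ρ̄_{W,2}` onto, `Δ_W > 0`, `#Sel₂(W) = 1`, beyond every bound a silent admissible prime `ℓ ≡ 7 (8)` with the DEF = 1 field
`ℚ(√−ℓ)` and a globally minimal twin with `#Sel₂ = 2`. [cite: MazurRubin2010, Prop. 3.3, Cor. 3.4 (i)] [cite: Kramer1981, §2 Prop. 6]
[cite: DokchitserDokchitserAnnals2010, Thm. 1.4] -/
theorem supply_DEF1_posDisc_of_print' (hmod : exists_isNewformOf) (hpar : ∀ (V : WeierstrassCurve ℚ) [V.IsElliptic], p_parity V 2)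
    (hCT : WeierstrassCurve.exists_casselsTate_pairing (K := ℚ)) (hΔ : 0 < W.Δ)
    (hsurj : W.HasSurjectiveModNGaloisRep 2) (h1 : Nat.card (W.selmerGroup 2) = 1) (b : ℕ) :
    ∃ ℓ : ℕ, b < ℓ ∧ ℓ.Prime ∧
      (∀ x : ZMod ℓ, 4 * x ^ 3 + ((integralModelInt W).b₂ : ZMod ℓ) * x ^ 2 +
        2 * ((integralModelInt W).b₄ : ZMod ℓ) * x + ((integralModelInt W).b₆ : ZMod ℓ) ≠ 0) ∧
      ∃ (K : Type) (_ : Field K) (_ : NumberField K), IsImaginaryQuadratic K ∧ discr K = -(ℓ : ℤ) ∧ Odd (discr K) ∧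
        discr K ≠ -3 ∧ SatisfiesHeegnerHypothesis (W.conductorNorm ℤ) K ∧
        ¬ IsSquare ((discr K : ℚ) * -|W.Δ|) ∧ ¬ IsSquare ((discr K : ℚ) * (-(2 * |W.Δ|))) ∧
        ((Ideal.span {(2 : ℤ)}).primesOver (𝓞 K)).ncard = 2 ∧
        (∀ [Fact ℓ.Prime], ∀ Q : (W.baseChange ℚ_[ℓ]).toAffine.Point, 2 • Q = 0 → Q = 0) ∧
        ∃ (Wd : WeierstrassCurve ℚ) (_ : Wd.IsElliptic) (_ : Wd.IsGloballyMinimal),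
          (∃ C : VariableChange ℚ, C • W.quadraticTwist (discr K : ℚ) = Wd) ∧ Nat.card (Wd.selmerGroup 2) = 2 := by
  have hT : NoRationalTwoTorsion W := noRationalTwoTorsion_of_hasSurjectiveModNGaloisRep W (by simpa using hsurj)
  obtain ⟨ℓ, hb, hℓ, hℓ8, hℓN, hsil⟩ := exists_silent_prime_gt W hΔ hsurj b
  exact ⟨ℓ, hb, hℓ, hsil, supply_DEF1_posDisc_of_shiftAt W
    (fun d hd ↦ admissibleTwistSelmerShiftAt_of_print' W hmod hpar hCT hΔ hT hd) h1 hℓ hℓ8 hℓN hsil⟩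

/-- **R-128 retype** (director-bsd 2026-08-29, T-Q381-1′) of `descentSignNeg_or_forall_minimalTwin_of_print`: the SAME statement and proof with the `2`-parity hypothesis in PRINT form `∀ (V : WeierstrassCurve ℚ) [V.IsElliptic], p_parity V 2` (Dokchitser–Dokchitser 2010 Thm. 1.4 is about elliptic curves; the bare closure over all Weierstrass cubics was off print). **Row 1 on `Δ > 0` is decided by the descent sign, modulo {modularity, 2-parity, Cassels–Tate}** (file 28's
`descentSignNeg_or_forall_minimalTwin_of_parity` with T-V from file 32's `strictShaPropagationAt_of_print'`).
[cite: MazurRubin2010, Cor. 3.4 (i)] [cite: Kramer1981, §2 Prop. 6] [cite: DokchitserDokchitserAnnals2010, Thm. 1.4] -/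
theorem descentSignNeg_or_forall_minimalTwin_of_print' (hmod : exists_isNewformOf) (hpar : ∀ (V : WeierstrassCurve ℚ) [V.IsElliptic], p_parity V 2)
    (hCT : WeierstrassCurve.exists_casselsTate_pairing (K := ℚ)) (hΔ : 0 < W.Δ)
    (hsurj : W.HasSurjectiveModNGaloisRep 2) (h4 : Nat.card (W.selmerGroup 2) = 4) :
    DescentSignNeg W ∨
      ∀ d : ℤ, DescAdmissible W d → ∀ (Wd : WeierstrassCurve ℚ) [Wd.IsElliptic],
        (∃ C : VariableChange ℚ, C • W.quadraticTwist (d : ℚ) = Wd) → Nat.card (Wd.selmerGroup 2) = 2 := by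
  have hT : NoRationalTwoTorsion W := noRationalTwoTorsion_of_hasSurjectiveModNGaloisRep W (by simpa using hsurj)
  rcases strictShaPropagationAt_of_print' W hmod hpar hCT hΔ hT (by rw [selmerTwoCard, h4]) with hall | hall
  · right
    intro d hd Wd _ hWd
    rw [natCard_selmerGroup_model_eq_twistSelmerTwoCard W hd.1.ne Wd hWd, hall d hd]
  · left
    obtain ⟨ℓ, -, hℓ, hℓ8, hℓN, hsil⟩ := exists_silent_prime_gt W hΔ hsurj 0
    refine ⟨-(ℓ : ℤ), descAdmissible_neg_prime_of_silent W hℓ hℓ8 hℓN hsil, ?_⟩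
    rw [hall _ (descAdmissible_neg_prime_of_silent W hℓ hℓ8 hℓN hsil), selmerTwoCard, h4]

/-- **R-128 retype** (director-bsd 2026-08-29, T-Q381-1′) of `supply_DEF1_minimalTwin_of_print`: the SAME statement and proof with the `2`-parity hypothesis in PRINT form `∀ (V : WeierstrassCurve ℚ) [V.IsElliptic], p_parity V 2` (Dokchitser–Dokchitser 2010 Thm. 1.4 is about elliptic curves; the bare closure over all Weierstrass cubics was off print). **SUPPLY″ FOR EVERY HABITAT CURVE, modulo {modularity, 2-parity, Cassels–Tate} ONLY** — file 28's `supply_DEF1_minimalTwin_of_parity''`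
VERBATIM with Kramer's congruence replaced by the three published inputs the route already lists as items (and still no T-A, no T-V, no
rank hypothesis). For `W/ℚ` globally minimal elliptic with `ρ̄_{W,2}` onto, `#Sel₂(W) ∈ {1, 4}`, and `¬ F1Sign2.DescentSignNeg W` whenever
`Δ_W > 0` and `#Sel₂(W) = 4`: beyond every bound `b` a prime `ℓ ≡ 7 (mod 8)`, `ℓ ∤ N_W`, with `K = ℚ(√−ℓ)` carrying EVERY K-clause of
crux 22136, `2` split, DEF(W,K) = 1 (root-count currency), and a GLOBALLY MINIMAL twin `Wd ≅ W^{(−ℓ)}` with `#Sel₂(Wd) = 2`. Rows: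
`{Δ<0, #Sel₂=1}` gk2-p4 `exists_prime_heegnerField_minimalTwin_of_facts'`; `{Δ<0, #Sel₂=4}` `supply_DEF1_minimalTwin_rowOne_of_duality`;
`{Δ>0, #Sel₂=1}` §80; `{Δ>0, #Sel₂=4}` file 28's row-1 theorem fed by file 32's T-V dichotomy. Poitou–Tate / Tate χ are the tree theorems
`poitouTate_selmerStructure_duality_real_holds`, `GenusKolyLowering.localEP`. The twin's analytic rank one is NOT asserted.
[cite: MazurRubin2010, Prop. 3.3, Cor. 3.4 (i), Prop. 5.3] [cite: Kramer1981, Prop. 6] [cite: DokchitserDokchitserAnnals2010, Thm. 1.4]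
[cite: GrossLMS1991, §1 (p. 235)] -/
theorem supply_DEF1_minimalTwin_of_print' (hmod : exists_isNewformOf) (hpar : ∀ (V : WeierstrassCurve ℚ) [V.IsElliptic], p_parity V 2)
    (hCT : WeierstrassCurve.exists_casselsTate_pairing (K := ℚ))
    (hsurj : W.HasSurjectiveModNGaloisRep 2)
    (h14 : Nat.card (W.selmerGroup 2) = 1 ∨ Nat.card (W.selmerGroup 2) = 4)
    (hε : 0 < W.Δ → Nat.card (W.selmerGroup 2) = 4 → ¬ DescentSignNeg W) (b : ℕ) :
    ∃ ℓ : ℕ, b < ℓ ∧ ℓ.Prime ∧ ℓ % 8 = 7 ∧ ¬ ℓ ∣ W.conductorNorm ℤ ∧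
      ((W.Δ < 0 ∧ ∃! x : ZMod ℓ, 4 * x ^ 3 + ((integralModelInt W).b₂ : ZMod ℓ) * x ^ 2 +
          2 * ((integralModelInt W).b₄ : ZMod ℓ) * x + ((integralModelInt W).b₆ : ZMod ℓ) = 0) ∨
        (0 < W.Δ ∧ ∀ x : ZMod ℓ, 4 * x ^ 3 + ((integralModelInt W).b₂ : ZMod ℓ) * x ^ 2 +
          2 * ((integralModelInt W).b₄ : ZMod ℓ) * x + ((integralModelInt W).b₆ : ZMod ℓ) ≠ 0)) ∧
      ∃ (K : Type) (_ : Field K) (_ : NumberField K), IsImaginaryQuadratic K ∧ discr K = -(ℓ : ℤ) ∧ Odd (discr K) ∧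
        discr K ≠ -3 ∧ SatisfiesHeegnerHypothesis (W.conductorNorm ℤ) K ∧
        ¬ IsSquare ((discr K : ℚ) * -|W.Δ|) ∧ ¬ IsSquare ((discr K : ℚ) * (-(2 * |W.Δ|))) ∧
        ((Ideal.span {(2 : ℤ)}).primesOver (𝓞 K)).ncard = 2 ∧
        ∃ (Wd : WeierstrassCurve ℚ) (_ : Wd.IsElliptic) (_ : Wd.IsGloballyMinimal),
          (∃ C : VariableChange ℚ, C • W.quadraticTwist (discr K : ℚ) = Wd) ∧ Nat.card (Wd.selmerGroup 2) = 2 := by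
  have hPT := poitouTate_selmerStructure_duality_real_holds (K := ℚ)
  have hEP := GenusKolyLowering.localEP ℚ
  have hT : NoRationalTwoTorsion W := noRationalTwoTorsion_of_hasSurjectiveModNGaloisRep W (by simpa using hsurj)
  rcases lt_or_gt_of_ne W.isUnit_Δ.ne_zero with hΔ | hΔ
  · -- `Δ < 0`: prime Heegner fields are transposition fields (DEF = 1 for free)
    rcases h14 with h1 | h4
    · obtain ⟨K, _, _, ℓ, hℓ, hb, hK, hd, hodd, hd3, hH, hsq1, hsq2, h2K, huniq, Wd, _, _, hWd, hSel⟩ :=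
        exists_prime_heegnerField_minimalTwin_of_facts' W hPT hEP hpar hCT hmod hΔ h1 b
      obtain ⟨-, hℓN, -⟩ := prime_discr_facts W hK hodd hH hℓ hd
      have hℓ8 : ℓ % 8 = 7 := by
        have h8 := (Quadratic.ncard_primesOver_two_eq_two_iff hK.1).mp h2K
        rw [hd] at h8
        omega
      exact ⟨ℓ, hb, hℓ, hℓ8, hℓN, Or.inl ⟨hΔ, huniq⟩, K, inferInstance, inferInstance, hK, hd, hodd, hd3, hH, hsq1, hsq2,
        h2K, Wd, inferInstance, inferInstance, hWd, hSel⟩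
    · obtain ⟨ℓ, hℓ, hb, hℓ8, hℓ2N, K, _, _, hK, hd, hodd, hd3, hH, hsq1, hsq2, h2K, huniq, Wd, _, _, hWd, hSel⟩ :=
        supply_DEF1_minimalTwin_rowOne_of_duality W hPT hEP hΔ hsurj h4 b
      have hℓN : ¬ ℓ ∣ W.conductorNorm ℤ := fun h => hℓ2N (Dvd.dvd.mul_left h 2)
      exact ⟨ℓ, hb, hℓ, hℓ8, hℓN, Or.inl ⟨hΔ, huniq⟩, K, inferInstance, inferInstance, hK, hd, hodd, hd3, hH, hsq1, hsq2,
        h2K, Wd, inferInstance, inferInstance, hWd, hSel⟩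
  · -- `Δ > 0`: silent prime Heegner fields; `#Sel₂ = 1` by §80, `#Sel₂ = 4` through file 32's T-V dichotomy
    rcases h14 with h1 | h4
    · obtain ⟨ℓ, hb, hℓ, hsil, K, _, _, hK, hd, hodd, hd3, hH, hsq1, hsq2, h2K, -, Wd, _, _, hWd, hSel⟩ :=
        supply_DEF1_posDisc_of_print' W hmod hpar hCT hΔ hsurj h1 b
      obtain ⟨-, hℓN, -⟩ := prime_discr_facts W hK hodd hH hℓ hd
      have hℓ8 : ℓ % 8 = 7 := by
        have h8 := (Quadratic.ncard_primesOver_two_eq_two_iff hK.1).mp h2K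
        rw [hd] at h8
        omega
      exact ⟨ℓ, hb, hℓ, hℓ8, hℓN, Or.inr ⟨hΔ, hsil⟩, K, inferInstance, inferInstance, hK, hd, hodd, hd3, hH, hsq1, hsq2,
        h2K, Wd, inferInstance, inferInstance, hWd, hSel⟩
    · obtain ⟨ℓ, hb, hℓ, hsil, K, _, _, hK, hd, hodd, hd3, hH, hsq1, hsq2, h2K, -, Wd, _, _, hWd, hSel⟩ :=
        supply_DEF1_posDisc_rowOne_of_not_descentSignNegAt W
          (strictShaPropagationAt_of_print' W hmod hpar hCT hΔ hT (by rw [selmerTwoCard, h4])) hΔ hsurj h4 (hε hΔ h4) b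
      obtain ⟨-, hℓN, -⟩ := prime_discr_facts W hK hodd hH hℓ hd
      have hℓ8 : ℓ % 8 = 7 := by
        have h8 := (Quadratic.ncard_primesOver_two_eq_two_iff hK.1).mp h2K
        rw [hd] at h8
        omega
      exact ⟨ℓ, hb, hℓ, hℓ8, hℓN, Or.inr ⟨hΔ, hsil⟩, K, inferInstance, inferInstance, hK, hd, hodd, hd3, hH, hsq1, hsq2,
        h2K, Wd, inferInstance, inferInstance, hWd, hSel⟩

/-- **SUPPLY″ under the habitat binder of crux 22136 (`ρ_{W,2^n}` onto for every `n ≥ 1`), BY THE ROUTE'S PRINT ITEMS**: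
`ModularityExistsNewform → TwoParityDD → CasselsTatePairingRat →` SUPPLY″ for every habitat curve with `#Sel₂(W) ∈ {1,4}` and
`¬DescentSignNeg W` on `{Δ > 0, #Sel₂ = 4}` — the three antecedents are stmt-19382 / 24949 / 19420, the print children that the crux
closer `GenusKolyLowering.genusPrimitiveSupplyAtTwo_of_kernels` already takes. (The crux's `r_an(W) = 0` is not needed for the supply;
the twin's analytic rank one is CONV₂ / Gross–Zagier and is NOT asserted.) [cite: MazurRubin2010, Prop. 3.3, Cor. 3.4 (i), Prop. 5.3]
[cite: DokchitserDokchitserAnnals2010, Thm. 1.4] [cite: GrossLMS1991, §1 (p. 235)] -/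
theorem supply_DEF1_minimalTwin_habitat_of_print (hmod : ModularityExistsNewform) (hDD : TwoParityDD)
    (hCT : CasselsTatePairingRat)
    (hρ : ∀ n : ℕ, 0 < n → W.HasSurjectiveModNGaloisRep ((2 : ℤ) ^ n))
    (h14 : Nat.card (W.selmerGroup 2) = 1 ∨ Nat.card (W.selmerGroup 2) = 4)
    (hε : 0 < W.Δ → Nat.card (W.selmerGroup 2) = 4 → ¬ DescentSignNeg W) (b : ℕ) :
    ∃ ℓ : ℕ, b < ℓ ∧ ℓ.Prime ∧ ℓ % 8 = 7 ∧ ¬ ℓ ∣ W.conductorNorm ℤ ∧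
      ((W.Δ < 0 ∧ ∃! x : ZMod ℓ, 4 * x ^ 3 + ((integralModelInt W).b₂ : ZMod ℓ) * x ^ 2 +
          2 * ((integralModelInt W).b₄ : ZMod ℓ) * x + ((integralModelInt W).b₆ : ZMod ℓ) = 0) ∨
        (0 < W.Δ ∧ ∀ x : ZMod ℓ, 4 * x ^ 3 + ((integralModelInt W).b₂ : ZMod ℓ) * x ^ 2 +
          2 * ((integralModelInt W).b₄ : ZMod ℓ) * x + ((integralModelInt W).b₆ : ZMod ℓ) ≠ 0)) ∧
      ∃ (K : Type) (_ : Field K) (_ : NumberField K), IsImaginaryQuadratic K ∧ discr K = -(ℓ : ℤ) ∧ Odd (discr K) ∧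
        discr K ≠ -3 ∧ SatisfiesHeegnerHypothesis (W.conductorNorm ℤ) K ∧
        ¬ IsSquare ((discr K : ℚ) * -|W.Δ|) ∧ ¬ IsSquare ((discr K : ℚ) * (-(2 * |W.Δ|))) ∧
        ((Ideal.span {(2 : ℤ)}).primesOver (𝓞 K)).ncard = 2 ∧
        ∃ (Wd : WeierstrassCurve ℚ) (_ : Wd.IsElliptic) (_ : Wd.IsGloballyMinimal),
          (∃ C : VariableChange ℚ, C • W.quadraticTwist (discr K : ℚ) = Wd) ∧ Nat.card (Wd.selmerGroup 2) = 2 :=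
  supply_DEF1_minimalTwin_of_print' W hmod hDD hCT (by simpa using hρ 1 one_pos) h14 hε b


end Summit.BirchSwinnertonDyer.BirchSwinnertonDyer.Theorems.GenusKolyTwin

end
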